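import Literature.Geometry.Riemannian.MeanConvexContractibleDisc
import Literature.Topology.FourManifolds.BoundaryOrientation
import HarnessLib

/-!
# Sweeney 2026, Prop. 1.2 for manifolds diffeomorphic to a ball; the case `n = 2` from the Poincaré conjecture
(topic `Geometry/Riemannian`)

Fourth proof file of the named fact `Literature.Geometry.Riemannian.Sweeney2026_pscMeanConvex`
(`MeanConvexContractible.lean`; P. Sweeney Jr., Math. Ann. (2026), Prop. 1.2, printed without
proof: compact contractible `(n+1)`-manifolds with boundary, Mazur if `n = 3`, carry metrics of
positive scalar curvature with mean-convex boundary). `MeanConvexContractibleDisc.lean` proved the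
conclusion for the closed ball `𝔻ⁿ⁺¹` with an arbitrary boundary datum; this file transports it
along diffeomorphisms of manifolds with boundary, which requires one piece of differential
topology — the differential of a diffeomorphism at a boundary point maps outward vectors to
outward vectors — and then settles the case `n = 2` of the fact modulo its (implicit) topological
input, the `3`-dimensional Poincaré conjecture in the form "compact contractible `3`-manifolds
with boundary are `3`-balls". Everything is PROVED:

* `mfderiv_diffeomorph_apply_zero_of_mem_boundary` — for a diffeomorphism `Θ : W ≅ W'` of
  manifolds with boundary and `z ∈ ∂W`, in the preferred boundary charts
  `(dΘ v)₀ = v₀ · (dΘ e₀)₀` with `(dΘ e₀)₀ > 0` (block-triangular differential with positive normal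
  entry: the chart map preserves the half-space and, by smooth invariance of the boundary —
  Mathlib's `Diffeomorph.image_boundary` — its boundary hyperplane, so the tree's
  `HalfSpace.hasFDerivAt_boundaryMap` / `HalfSpace.det_pos_iff` of `BoundaryOrientation.lean`
  apply; Hirsch 1976, §4.4; Lee 2013, Prop. 15.24); hence `mfderiv_diffeomorph_apply_zero_neg`:
  outward vectors (`v₀ < 0`) go to outward vectors;
* `mfderiv_diffeomorph_comp_mfderiv_symm` — `dΘ ∘ d(Θ⁻¹) = id`;
* `boundaryDataPushforward` — a boundary datum `(B, incl)` of `X` pushed forward along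
  `Ψ : X ≅ X'` is a boundary datum `(B, Ψ ∘ incl)` of `X'`
  (`IsSmoothEmbedding.diffeomorph_comp`, `Diffeomorph.image_boundary`);
* `pscMeanConvex_of_diffeomorph_of_sphereImmersion` — **transport**: if `Ψ : X ≅ X'` and `X'`
  carries the data of `pscMeanConvex_of_sphereImmersion` (`MeanConvexContractibleProofs.lean`)
  relative to the pushed-forward boundary datum, then `X` satisfies the conclusion of the fact
  relative to `bX` (map `Φ ∘ Ψ`, same normal field; the normal stays outward by the first item
  applied to `Ψ⁻¹`) — so the remaining topological inputs of Prop. 1.2 may be supplied up to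
  diffeomorphism;
* `pscMeanConvex_of_diffeomorph_closedBall` — **every smooth `(n+1)`-manifold with boundary
  diffeomorphic to `𝔻ⁿ⁺¹`, `n ≥ 1`, with any boundary datum, carries a Riemannian metric of
  positive scalar curvature whose boundary is a spacelike immersion with smooth outward unit
  normal of positive mean curvature** (the conclusion of `Sweeney2026_pscMeanConvex`), by
  transport of the disc-to-cap data of `MeanConvexContractibleDisc.lean`;
* `Sweeney2026_pscMeanConvex_two_of_ball` — the case `n = 2` of the fact from the statement
  that every compact contractible smooth `3`-manifold with boundary is diffeomorphic to `𝔻³`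
  (Perelman + Schoenflies; hypothesis spelled out inline, NOT a new named fact).

## References

* P. Sweeney Jr., *Positive curvature conditions on contractible manifolds*, Math. Ann. (2026)
  = arXiv:2507.15719, Prop. 1.2 (p. 4). [Sweeney2026]
* M. W. Hirsch, *Differential Topology*, GTM 33 (1976), Ch. 4 §4, p. 103. [HirschDT1976]
* J. M. Lee, *Introduction to Smooth Manifolds*, 2nd ed., GTM 218 (2013), Thm. 1.46,
  Prop. 15.24. [LeeSmoothManifolds2013]
-/

noncomputable section

open Bundle Set Function Metric Module Filter
open scoped Manifold ContDiff Topology RealInnerProductSpace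

namespace Literature.Geometry.Riemannian

open Lorentzian Lorentzian.PseudoRiemannianMetric

/-! ### Transport along diffeomorphisms of manifolds with boundary -/

section Transport

open Literature.Topology.FourManifolds Literature.Topology.FourManifolds.BoundaryManifold

attribute [local instance] Literature.Topology.FourManifolds.fact_finrank_euclideanSpace_succ

variable {n : ℕ}

/-- **The differential of a diffeomorphism at a boundary point is block-triangular with positive
normal entry.** For a `C^∞` diffeomorphism `Θ : W ≅ W'` of manifolds with boundary and `z ∈ ∂W`,
read in the preferred (boundary) charts: `(dΘ v)₀ = v₀ · (dΘ e₀)₀` for every `v ∈ T_z W = ℝⁿ⁺¹`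
and `(dΘ e₀)₀ > 0` for the inward normal `e₀`; in particular `dΘ` maps inward vectors
(`v₀ > 0`) to inward vectors and outward vectors (`v₀ < 0`) to outward vectors. The chart map
`τ = φ' ∘ Θ ∘ φ⁻¹` maps the half-space into itself and its boundary hyperplane into itself
(smooth invariance of the boundary, `Diffeomorph.image_boundary`), so the tree's calculus at a
boundary point applies (`HalfSpace.hasFDerivAt_boundaryMap`: `dΘ` preserves the hyperplane;
`HalfSpace.det_pos_iff`: positive normal entry, `BoundaryOrientation.lean`; Hirsch 1976, §4.4,
p. 103; Lee 2013, Prop. 15.24). [folklore] -/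
theorem mfderiv_diffeomorph_apply_zero_of_mem_boundary {W : Type*} [TopologicalSpace W]
    [ChartedSpace (EuclideanHalfSpace (n + 1)) W] [IsManifold (𝓡∂ (n + 1)) ∞ W]
    {W' : Type*} [TopologicalSpace W'] [ChartedSpace (EuclideanHalfSpace (n + 1)) W']
    [IsManifold (𝓡∂ (n + 1)) ∞ W'] (Θ : W ≃ₘ⟮𝓡∂ (n + 1), 𝓡∂ (n + 1)⟯ W') {z : W}
    (hz : z ∈ (𝓡∂ (n + 1)).boundary W) (v : EuclideanSpace ℝ (Fin (n + 1))) :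
    (show EuclideanSpace ℝ (Fin (n + 1)) from mfderiv (𝓡∂ (n + 1)) (𝓡∂ (n + 1)) Θ z v) 0 =
        v 0 * (show EuclideanSpace ℝ (Fin (n + 1)) from
          mfderiv (𝓡∂ (n + 1)) (𝓡∂ (n + 1)) Θ z (e0 n)) 0 ∧
      0 < (show EuclideanSpace ℝ (Fin (n + 1)) from
        mfderiv (𝓡∂ (n + 1)) (𝓡∂ (n + 1)) Θ z (e0 n)) 0 := by
  set L : EuclideanSpace ℝ (Fin (n + 1)) →L[ℝ] EuclideanSpace ℝ (Fin (n + 1)) :=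
    mfderiv (𝓡∂ (n + 1)) (𝓡∂ (n + 1)) Θ z with hL_def
  change L v 0 = v 0 * L (e0 n) 0 ∧ 0 < L (e0 n) 0
  set e := chartAt (EuclideanHalfSpace (n + 1)) z with he
  set e' := chartAt (EuclideanHalfSpace (n + 1)) (Θ z) with he'
  set x : EuclideanSpace ℝ (Fin (n + 1)) := extChartAt (𝓡∂ (n + 1)) z z with hx_def
  have hx : x 0 = 0 := (mem_boundary_iff_of_mem_atlas (chart_mem_atlas _ z) (mem_chart_source _ z)).1 hz
  have hΘd : MDifferentiableAt (𝓡∂ (n + 1)) (𝓡∂ (n + 1)) Θ z :=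
    (Θ.contMDiff z).mdifferentiableAt (by simp)
  set τ : EuclideanSpace ℝ (Fin (n + 1)) → EuclideanSpace ℝ (Fin (n + 1)) :=
    extChartAt (𝓡∂ (n + 1)) (Θ z) ∘ Θ ∘ (extChartAt (𝓡∂ (n + 1)) z).symm with hτ_def
  have hL : HasFDerivWithinAt τ L (range (𝓡∂ (n + 1))) x := hΘd.hasMFDerivAt.2
  have hτapp : ∀ y, τ y = (e' (Θ (e.symm ((𝓡∂ (n + 1)).symm y)))).val := fun y ↦ rfl
  -- `τ` takes values in the half-space
  have hK : ∀ y, 0 ≤ τ y 0 := fun y ↦ by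
    rw [hτapp]
    exact (e' _).2
  -- near `tail x`, `τ (0, u) = (0, σ u)` with `σ` the boundary map read in the boundary charts
  set σ : EuclideanSpace ℝ (Fin n) → EuclideanSpace ℝ (Fin n) := fun u ↦
    tail n (e' (Θ (e.symm (toHalfSpace n u)))).val with hσ_def
  have hu₀ : toHalfSpace n (tail n x) = e z :=
    toHalfSpace_tail_chart (chart_mem_atlas _ z) (mem_chart_source _ z) hz
  have h1 : ∀ᶠ u in 𝓝 (tail n x), toHalfSpace n u ∈ e.target := by
    refine (continuous_toHalfSpace n).continuousAt.preimage_mem_nhds ?_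
    rw [hu₀]
    exact e.open_target.mem_nhds (e.map_source (mem_chart_source _ z))
  have h2 : ∀ᶠ u in 𝓝 (tail n x), Θ (e.symm (toHalfSpace n u)) ∈ e'.source := by
    have hc : ContinuousAt (fun u ↦ Θ (e.symm (toHalfSpace n u))) (tail n x) := by
      refine ContinuousAt.comp (g := Θ) Θ.continuous.continuousAt ?_
      refine ContinuousAt.comp (g := e.symm) ?_ (continuous_toHalfSpace n).continuousAt
      rw [hu₀]
      exact e.continuousAt_symm (e.map_source (mem_chart_source _ z))
    refine hc.preimage_mem_nhds (e'.open_source.mem_nhds ?_)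
    rw [hu₀, e.left_inv (mem_chart_source _ z)]
    exact mem_chart_source _ (Θ z)
  have hστ : ∀ᶠ u in 𝓝 (tail n x), τ (consZeroL n u) = consZeroL n (σ u) := by
    filter_upwards [h1, h2] with u hu hu'
    have hw : e.symm (toHalfSpace n u) ∈ (𝓡∂ (n + 1)).boundary W :=
      symm_toHalfSpace_mem_boundary (chart_mem_atlas _ z) hu
    have hw' : Θ (e.symm (toHalfSpace n u)) ∈ (𝓡∂ (n + 1)).boundary W' := by
      rw [← Θ.image_boundary (by simp)]
      exact mem_image_of_mem Θ hw
    have hb' : (e' (Θ (e.symm (toHalfSpace n u)))).val 0 = 0 :=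
      (mem_boundary_iff_of_mem_atlas (chart_mem_atlas _ (Θ z)) hu').1 hw'
    rw [hτapp, consZeroL_apply, modelWithCorners_symm_consCLE, consZeroL_apply,
      ← consCLE_tail_of_eq_zero n hb']
  -- the differential is invertible
  have hLdet : LinearMap.det (L : EuclideanSpace ℝ (Fin (n + 1)) →ₗ[ℝ] EuclideanSpace ℝ (Fin (n + 1))) ≠ 0 :=
    ((Θ.mfderivToContinuousLinearEquiv (by simp) z).toLinearEquiv.isUnit_det').ne_zero
  have hblock := (HalfSpace.hasFDerivAt_boundaryMap hx hL hστ).2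
  have hpos := (HalfSpace.det_pos_iff hx hL hστ hK hLdet).1
  refine ⟨?_, hpos⟩
  have hv : consZeroL n (tail n v) + v 0 • e0 n = v := by rw [consZeroL_add_smul_e0, consCLE_tail]
  have h3 := congrArg (fun f : EuclideanSpace ℝ (Fin n) →L[ℝ] EuclideanSpace ℝ (Fin (n + 1)) ↦
    f (tail n v) 0) hblock
  simp only [ContinuousLinearMap.comp_apply, consZeroL_apply_zero] at h3
  conv_lhs => rw [← hv]
  rw [map_add, map_smul, PiLp.add_apply, PiLp.smul_apply, h3, zero_add, smul_eq_mul]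

/-- Hence **a diffeomorphism of manifolds with boundary maps outward vectors to outward vectors**:
at `z ∈ ∂W`, `v₀ < 0` implies `(dΘ v)₀ < 0` (in the preferred boundary charts). [folklore] -/
theorem mfderiv_diffeomorph_apply_zero_neg {W : Type*} [TopologicalSpace W]
    [ChartedSpace (EuclideanHalfSpace (n + 1)) W] [IsManifold (𝓡∂ (n + 1)) ∞ W]
    {W' : Type*} [TopologicalSpace W'] [ChartedSpace (EuclideanHalfSpace (n + 1)) W']
    [IsManifold (𝓡∂ (n + 1)) ∞ W'] (Θ : W ≃ₘ⟮𝓡∂ (n + 1), 𝓡∂ (n + 1)⟯ W') {z : W}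
    (hz : z ∈ (𝓡∂ (n + 1)).boundary W) {v : EuclideanSpace ℝ (Fin (n + 1))} (hv : v 0 < 0) :
    (show EuclideanSpace ℝ (Fin (n + 1)) from mfderiv (𝓡∂ (n + 1)) (𝓡∂ (n + 1)) Θ z v) 0 < 0 := by
  obtain ⟨h1, h2⟩ := mfderiv_diffeomorph_apply_zero_of_mem_boundary Θ hz v
  rw [h1]
  exact mul_neg_of_neg_of_pos hv h2

/-- The differentials of a diffeomorphism and of its inverse are inverse to each other:
`dΘ_z ∘ d(Θ⁻¹)_{Θ z} = id` (chain rule for `Θ ∘ Θ⁻¹ = id`). [folklore] -/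
theorem mfderiv_diffeomorph_comp_mfderiv_symm {E H : Type*} [NormedAddCommGroup E] [NormedSpace ℝ E]
    [TopologicalSpace H] {I : ModelWithCorners ℝ E H} {M : Type*} [TopologicalSpace M]
    [ChartedSpace H M] [IsManifold I ∞ M] {M' : Type*} [TopologicalSpace M'] [ChartedSpace H M']
    [IsManifold I ∞ M'] (Θ : M ≃ₘ⟮I, I⟯ M') (x : M) :
    (mfderiv I I Θ x).comp (mfderiv I I Θ.symm (Θ x)) = ContinuousLinearMap.id ℝ (TangentSpace I (Θ x)) := by
  have h1 : MDifferentiableAt I I Θ (Θ.symm (Θ x)) := by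
    rw [Θ.symm_apply_apply]; exact (Θ.contMDiff x).mdifferentiableAt (by simp)
  have h2 : MDifferentiableAt I I Θ.symm (Θ x) := (Θ.symm.contMDiff (Θ x)).mdifferentiableAt (by simp)
  have h := mfderiv_comp (Θ x) h1 h2
  rw [Θ.symm_apply_apply] at h
  have hid : (Θ ∘ Θ.symm : M' → M') = id := funext Θ.apply_symm_apply
  rw [← h, hid, mfderiv_id]

variable {X : Type} [TopologicalSpace X] [ChartedSpace (EuclideanHalfSpace (n + 1)) X]
  [IsManifold (𝓡∂ (n + 1)) ∞ X] {X' : Type} [TopologicalSpace X']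
  [ChartedSpace (EuclideanHalfSpace (n + 1)) X'] [IsManifold (𝓡∂ (n + 1)) ∞ X']

/-- **Pushing a boundary datum forward along a diffeomorphism**: if `(B, incl)` is a boundary
datum of `X` and `Ψ : X ≅ X'`, then `(B, Ψ ∘ incl)` is a boundary datum of `X'` (a diffeomorphism
composed with a smooth embedding is a smooth embedding, `IsSmoothEmbedding.diffeomorph_comp`,
and diffeomorphisms map the boundary onto the boundary, Mathlib's `Diffeomorph.image_boundary`).
[folklore] -/
def boundaryDataPushforward (bX : BoundaryData (𝓡∂ (n + 1)) X (𝓡 n))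
    (Ψ : X ≃ₘ⟮𝓡∂ (n + 1), 𝓡∂ (n + 1)⟯ X') : BoundaryData (𝓡∂ (n + 1)) X' (𝓡 n) where
  carrier := bX.carrier
  incl := Ψ ∘ bX.incl
  isSmoothEmbedding := bX.isSmoothEmbedding.diffeomorph_comp Ψ
  range_incl := by rw [Set.range_comp, bX.range_incl, Ψ.image_boundary (by simp)]

/-- The inclusion of the pushed-forward boundary datum is `Ψ ∘ incl` (definitional). [folklore] -/
@[simp] theorem boundaryDataPushforward_incl (bX : BoundaryData (𝓡∂ (n + 1)) X (𝓡 n))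
    (Ψ : X ≃ₘ⟮𝓡∂ (n + 1), 𝓡∂ (n + 1)⟯ X') : (boundaryDataPushforward bX Ψ).incl = Ψ ∘ bX.incl := rfl

variable (n) in
/-- **Transport of sphere-immersion data along a diffeomorphism.** Let `Ψ : X ≅ X'` be a
diffeomorphism of `(n+1)`-manifolds with boundary, `bX` a boundary datum of `X` and `bX_* = (B, Ψ ∘ incl)`
its push-forward to `X'` (`boundaryDataPushforward`). If `X'` carries the data of
`pscMeanConvex_of_sphereImmersion` relative to `bX_*` — a smooth map `Φ` into the round `Sⁿ⁺¹`
with injective differentials under which `Φ ∘ Ψ ∘ incl` is a spacelike immersion with a smooth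
outward round-unit normal field of positive mean curvature — then so does `X` relative to `bX`,
with the map `Φ ∘ Ψ` and the same normal field; hence `X` carries a Riemannian metric of positive
scalar curvature with mean-convex boundary in the sense of
`Literature.Geometry.Riemannian.Sweeney2026_pscMeanConvex`. The one point that is not formal is
outwardness: `(d(Φ ∘ Ψ))⁻¹ ν = d(Ψ⁻¹) ((dΦ)⁻¹ ν)` and `d(Ψ⁻¹)` maps outward vectors to outward
vectors (`mfderiv_diffeomorph_apply_zero_neg`). [cite: Sweeney2026, Prop. 1.2] -/
theorem pscMeanConvex_of_diffeomorph_of_sphereImmersion (hn : 1 ≤ n)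
    (bX : BoundaryData (𝓡∂ (n + 1)) X (𝓡 n)) (Ψ : X ≃ₘ⟮𝓡∂ (n + 1), 𝓡∂ (n + 1)⟯ X')
    (V : Type*) [NormedAddCommGroup V] [InnerProductSpace ℝ V]
    [Fact (Module.finrank ℝ V = (n + 1) + 1)] [(roundMetric (n := n + 1) V).HasLeviCivita]
    {Φ : X' → Metric.sphere (0 : V) 1} (hΦ : ContMDiff (𝓡∂ (n + 1)) (𝓡 (n + 1)) ∞ Φ)
    (hΦ' : ∀ x, Injective (mfderiv (𝓡∂ (n + 1)) (𝓡 (n + 1)) Φ x))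
    (hΦb : (roundMetric (n := n + 1) V).IsSpacelikeImmersion (𝓡 n)
      (Φ ∘ (boundaryDataPushforward bX Ψ).incl))
    {νM : NormalField (𝓡 (n + 1)) (Φ ∘ (boundaryDataPushforward bX Ψ).incl)}
    (hν : (roundMetric (n := n + 1) V).IsUnitNormal (𝓡 n) (Φ ∘ (boundaryDataPushforward bX Ψ).incl) νM 1)
    (hνs : ContMDiff (𝓡 n) (𝓡 (n + 1)).tangent ∞
      (fun z ↦ (TotalSpace.mk' (EuclideanSpace ℝ (Fin (n + 1)))
        (Φ ((boundaryDataPushforward bX Ψ).incl z)) (νM z) : TangentBundle (𝓡 (n + 1)) (Metric.sphere (0 : V) 1))))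
    (hout : ∀ z, (show EuclideanSpace ℝ (Fin (n + 1)) from
      (mfderiv (𝓡∂ (n + 1)) (𝓡 (n + 1)) Φ ((boundaryDataPushforward bX Ψ).incl z)).inverse (νM z)) 0 < 0)
    (hH : ∀ z, 0 < (roundMetric (n := n + 1) V).meanCurvature (Φ ∘ (boundaryDataPushforward bX Ψ).incl)
      PseudoRiemannianMetric.contMDiff_pullbackBilin_holds hΦb νM z) :
    ∃ g : PseudoRiemannianMetric (𝓡∂ (n + 1)) ∞ (EuclideanSpace ℝ (Fin (n + 1)))
        (TangentSpace (𝓡∂ (n + 1)) : X → Type _),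
    ∃ _ : g.HasLeviCivita, ∃ hf : g.IsSpacelikeImmersion (𝓡 n) bX.incl,
    ∃ ν : NormalField (𝓡∂ (n + 1)) bX.incl,
      g.IsRiemannian ∧ (∀ x, 0 < g.scalarCurvature x) ∧ g.IsUnitNormal (𝓡 n) bX.incl ν 1 ∧
      ContMDiff (𝓡 n) (𝓡∂ (n + 1)).tangent ∞
        (fun z ↦ (TotalSpace.mk' (EuclideanSpace ℝ (Fin (n + 1))) (bX.incl z) (ν z) :
          TangentBundle (𝓡∂ (n + 1)) X)) ∧
      (∀ z, (show EuclideanSpace ℝ (Fin (n + 1)) from ν z) 0 < 0) ∧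
      ∀ z, 0 < g.meanCurvature bX.incl
        PseudoRiemannianMetric.contMDiff_pullbackBilin_holds hf ν z := by
  have hΨd : ∀ x, MDifferentiableAt (𝓡∂ (n + 1)) (𝓡∂ (n + 1)) Ψ x := fun x ↦
    (Ψ.contMDiff x).mdifferentiableAt (by simp)
  have hcomp : ∀ x, mfderiv (𝓡∂ (n + 1)) (𝓡 (n + 1)) (Φ ∘ Ψ) x =
      (mfderiv (𝓡∂ (n + 1)) (𝓡 (n + 1)) Φ (Ψ x)).comp
        (mfderiv (𝓡∂ (n + 1)) (𝓡∂ (n + 1)) Ψ x) := fun x ↦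
    mfderiv_comp x ((hΦ _).mdifferentiableAt (by simp)) (hΨd x)
  have hΦ'' : ∀ x, Injective (mfderiv (𝓡∂ (n + 1)) (𝓡 (n + 1)) (Φ ∘ Ψ) x) := fun x ↦ by
    rw [hcomp]
    exact (hΦ' _).comp (Ψ.mfderivToContinuousLinearEquiv (by simp) x).injective
  -- outwardness: `(d(Φ ∘ Ψ))⁻¹ ν = d(Ψ⁻¹) ((dΦ)⁻¹ ν)`
  have hinv : ∀ z, (mfderiv (𝓡∂ (n + 1)) (𝓡 (n + 1)) (Φ ∘ Ψ) (bX.incl z)).inverse (νM z) =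
      mfderiv (𝓡∂ (n + 1)) (𝓡∂ (n + 1)) Ψ.symm ((boundaryDataPushforward bX Ψ).incl z)
        ((mfderiv (𝓡∂ (n + 1)) (𝓡 (n + 1)) Φ ((boundaryDataPushforward bX Ψ).incl z)).inverse (νM z)) := fun z ↦ by
    have hI : (mfderiv (𝓡∂ (n + 1)) (𝓡 (n + 1)) (Φ ∘ Ψ) (bX.incl z)).IsInvertible :=
      PseudoRiemannianMetric.isInvertible_mfderiv_of_injective rfl (hΦ'' _)
    have hA : (mfderiv (𝓡∂ (n + 1)) (𝓡 (n + 1)) Φ ((boundaryDataPushforward bX Ψ).incl z)).IsInvertible :=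
      PseudoRiemannianMetric.isInvertible_mfderiv_of_injective rfl (hΦ' _)
    set w := (mfderiv (𝓡∂ (n + 1)) (𝓡 (n + 1)) Φ ((boundaryDataPushforward bX Ψ).incl z)).inverse (νM z) with hw
    have key : mfderiv (𝓡∂ (n + 1)) (𝓡 (n + 1)) (Φ ∘ Ψ) (bX.incl z)
        (mfderiv (𝓡∂ (n + 1)) (𝓡∂ (n + 1)) Ψ.symm ((boundaryDataPushforward bX Ψ).incl z) w) = νM z := by
      rw [hcomp]
      have hBB := congrArg (fun f : TangentSpace (𝓡∂ (n + 1)) (Ψ (bX.incl z)) →L[ℝ]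
        TangentSpace (𝓡∂ (n + 1)) (Ψ (bX.incl z)) ↦ f w)
          (mfderiv_diffeomorph_comp_mfderiv_symm Ψ (bX.incl z))
      simp only [ContinuousLinearMap.comp_apply, ContinuousLinearMap.id_apply] at hBB
      exact (congrArg (mfderiv (𝓡∂ (n + 1)) (𝓡 (n + 1)) Φ ((boundaryDataPushforward bX Ψ).incl z)) hBB).trans
        (hA.self_apply_inverse (νM z))
    conv_lhs => rw [← key]
    exact hI.inverse_apply_self _
  have hout' : ∀ z, (show EuclideanSpace ℝ (Fin (n + 1)) from
      (mfderiv (𝓡∂ (n + 1)) (𝓡 (n + 1)) (Φ ∘ Ψ) (bX.incl z)).inverse (νM z)) 0 < 0 := fun z ↦ by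
    have h := mfderiv_diffeomorph_apply_zero_neg Ψ.symm ((boundaryDataPushforward bX Ψ).incl_mem_boundary z) (hout z)
    rw [← hinv z] at h
    exact h
  exact pscMeanConvex_of_sphereImmersion n hn X bX V (hΦ.comp Ψ.contMDiff) hΦ'' hΦb hν hνs hout' hH

variable (n) in
/-- **Manifolds with boundary diffeomorphic to the closed ball carry PSC metrics with mean-convex
boundary** — the conclusion of `Literature.Geometry.Riemannian.Sweeney2026_pscMeanConvex` for every
smooth `(n+1)`-manifold with boundary `X` diffeomorphic to `𝔻ⁿ⁺¹`, `n ≥ 1`, and every boundary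
datum of `X`: `pscMeanConvex_of_diffeomorph_of_sphereImmersion` with the disc-to-cap data of
`MeanConvexContractibleDisc.lean` for the pushed-forward boundary datum of `𝔻ⁿ⁺¹` (unit normal,
smoothness, outwardness, `H = n`). For `n = 2` this is the whole of Sweeney's Prop. 1.2 modulo the
theorem that compact contractible `3`-manifolds with boundary are `3`-balls (Perelman).
[cite: Sweeney2026, Prop. 1.2] -/
theorem pscMeanConvex_of_diffeomorph_closedBall (hn : 1 ≤ n) (bX : BoundaryData (𝓡∂ (n + 1)) X (𝓡 n))
    (Ψ : X ≃ₘ⟮𝓡∂ (n + 1), 𝓡∂ (n + 1)⟯ (Metric.closedBall (0 : EuclideanSpace ℝ (Fin (n + 1))) 1)) :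
    ∃ g : PseudoRiemannianMetric (𝓡∂ (n + 1)) ∞ (EuclideanSpace ℝ (Fin (n + 1)))
        (TangentSpace (𝓡∂ (n + 1)) : X → Type _),
    ∃ _ : g.HasLeviCivita, ∃ hf : g.IsSpacelikeImmersion (𝓡 n) bX.incl,
    ∃ ν : NormalField (𝓡∂ (n + 1)) bX.incl,
      g.IsRiemannian ∧ (∀ x, 0 < g.scalarCurvature x) ∧ g.IsUnitNormal (𝓡 n) bX.incl ν 1 ∧
      ContMDiff (𝓡 n) (𝓡∂ (n + 1)).tangent ∞
        (fun z ↦ (TotalSpace.mk' (EuclideanSpace ℝ (Fin (n + 1))) (bX.incl z) (ν z) :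
          TangentBundle (𝓡∂ (n + 1)) X)) ∧
      (∀ z, (show EuclideanSpace ℝ (Fin (n + 1)) from ν z) 0 < 0) ∧
      ∀ z, 0 < g.meanCurvature bX.incl
        PseudoRiemannianMetric.contMDiff_pullbackBilin_holds hf ν z := by
  haveI : (roundMetric (n := n + 1) (EuclideanSpace ℝ (Fin (n + 1 + 1)))).HasLeviCivita :=
    (roundMetric (n := n + 1) (EuclideanSpace ℝ (Fin (n + 1 + 1)))).hasLeviCivita
  set bX' := boundaryDataPushforward bX Ψ with hbX'
  have hout : ∀ z, (show EuclideanSpace ℝ (Fin (n + 1)) from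
      (mfderiv (𝓡∂ (n + 1)) (𝓡 (n + 1)) (discCapMap n) (bX'.incl z)).inverse (discNormal bX' z)) 0 < 0 :=
    fun z ↦ by
    have h := closedBallCoeDeriv_symm_two_smul_apply_zero bX' z
    rw [← inverse_mfderiv_discNormal bX' z] at h
    exact h
  exact pscMeanConvex_of_diffeomorph_of_sphereImmersion n hn bX Ψ (EuclideanSpace ℝ (Fin (n + 1 + 1)))
    (contMDiff_discCapMap n) (mfderiv_discCapMap_injective n)
    (isSpacelikeImmersion_discCapMap_comp_incl bX') (isUnitNormal_discNormal bX')
    (contMDiff_discNormal bX') hout fun z ↦ by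
      rw [meanCurvature_discNormal bX' z]; exact_mod_cast hn

/-- **Sweeney 2026, Prop. 1.2 in dimension `3` (`n = 2`), from the Poincaré conjecture.** The
case `n = 2` of `Literature.Geometry.Riemannian.Sweeney2026_pscMeanConvex` — every compact
contractible smooth `3`-manifold with boundary carries a Riemannian metric of positive scalar
curvature with mean-convex boundary — follows from `pscMeanConvex_of_diffeomorph_closedBall` and
the classification input used (implicitly) by Sweeney: a compact contractible smooth `3`-manifold
with boundary is diffeomorphic to the closed `3`-ball (Perelman's theorem together with the
`3`-dimensional Schoenflies theorem; the statement quantifies over all compact contractible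
`X` charted on the half-space, the closed case being vacuous). The hypothesis is spelled out
inline; it is the part of the argument not in the tree. [cite: Sweeney2026, Prop. 1.2] -/
theorem Sweeney2026_pscMeanConvex_two_of_ball
    (ball : ∀ (X : Type) [TopologicalSpace X] [T2Space X] [SecondCountableTopology X]
      [ChartedSpace (EuclideanHalfSpace 3) X] [IsManifold (𝓡∂ 3) ∞ X] [CompactSpace X]
      [ContractibleSpace X],
        Nonempty (X ≃ₘ⟮𝓡∂ 3, 𝓡∂ 3⟯ (Metric.closedBall (0 : EuclideanSpace ℝ (Fin 3)) 1)))
    (X : Type) [TopologicalSpace X] [T2Space X] [SecondCountableTopology X]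
    [ChartedSpace (EuclideanHalfSpace 3) X] [IsManifold (𝓡∂ 3) ∞ X] [CompactSpace X]
    [ContractibleSpace X] (bX : BoundaryData (𝓡∂ 3) X (𝓡 2)) :
    ∃ g : PseudoRiemannianMetric (𝓡∂ 3) ∞ (EuclideanSpace ℝ (Fin 3))
        (TangentSpace (𝓡∂ 3) : X → Type _),
    ∃ _ : g.HasLeviCivita, ∃ hf : g.IsSpacelikeImmersion (𝓡 2) bX.incl,
    ∃ ν : NormalField (𝓡∂ 3) bX.incl,
      g.IsRiemannian ∧ (∀ x, 0 < g.scalarCurvature x) ∧ g.IsUnitNormal (𝓡 2) bX.incl ν 1 ∧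
      ContMDiff (𝓡 2) (𝓡∂ 3).tangent ∞
        (fun z ↦ (TotalSpace.mk' (EuclideanSpace ℝ (Fin 3)) (bX.incl z) (ν z) :
          TangentBundle (𝓡∂ 3) X)) ∧
      (∀ z, (show EuclideanSpace ℝ (Fin 3) from ν z) 0 < 0) ∧
      ∀ z, 0 < g.meanCurvature bX.incl
        PseudoRiemannianMetric.contMDiff_pullbackBilin_holds hf ν z :=
  pscMeanConvex_of_diffeomorph_closedBall 2 (by norm_num) bX (ball X).some


end Transport

end Literature.Geometry.Riemannian

end
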